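import Summits.Parity.GeneralizedHardyLittlewood.Theorems.PrimeLevelFamEdgeMomentsBeyondDiagonalDiagOrderPos
import Summits.Parity.GeneralizedHardyLittlewood.Theorems.PrimeLevelFamEdgeMomentsBeyondDiagonalDiagLineDecorated
import HarnessLib

/-!
# Route `PrimeLevelFamEdge`, crux K_A `MomentsBeyondDiagonal` (stmt-Parity-20007), line «petersson_layers» v4, stub `stub_diag`:
# **the per-order targets in REAL, DECORATED SELBERG COORDINATES** (the input form of the `…DiagDecor*` / `…DiagCoprime` engines)

`…DiagOrderPos` (p821856) reduces the registered stub `stub_diag : SubDiag` to one complex-normed asymptotic per order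
`(i,j) ≠ (0,0)`, `i+j` even, for the inner sum `S_{ij}(q,P,Δ') = Σ_{m₁,m₂≤M} x x Σ_{d₁∣m₁,d₂∣m₂} c (m₁m₂)^{−1/2} 𝔚_{ij}(A₁,A₂;K/q̂²)`.
By `…DiagLineDecorated.sum_mollifierCoeff_hecke_eq_decorated` (p817555) that inner sum IS, as a real number, the decorated
Selberg-coordinate sum
`Sel_{ij}(q,P,Δ') = Σ_{c≤N}Σ_{g≤N/c} μ(g)·c·Σ_{k₁,k₂≤N/(cg)} (x′_{cgk₁}/(cgk₁))(x′_{cgk₂}/(cgk₂)) Σ_{d∣k₁}Σ_{e∣k₂}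
   𝔚_{ij}(log(q̂/n₁), log(q̂/n₂); n₁n₂/q̂²)`, `n₁ = (k₁/d)(ge)`, `n₂ = (gd)(k₂/e)`, `N = ⌊q̂^{Δ'}⌋`, `x′_m = μ(m)ψ(m)⁻¹P(log(M/m)/log M)`,
and `2ζ(2)² = 2(π²/6)²` is real. Hence:

* `hasShape_diagPart_of_selbergOrderAsymptotics` / `subDiag_of_selbergOrderAsymptotics` — **`SubDiag` follows from the REAL
  targets `|ℓ^{−(i+j)} q̂ Sel_{ij}(q,P,Δ') − 2(π²/6)² q̂/(Δ'²ℓ²)·τ_{ij}(Δ',P)| ≤ C q̂ ℓ⁻³` (`q ≥ q₀`) for the orders `(i,j) ≠ (0,0)`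
  with `i+j` even** (`τ₀₀ = secondMomentForm Δ' P 1 / 2`; window `(1, Δ]`, `Δ ≤ 3/2`).

Def-free; helper `--supports stmt-Parity-20007`; closes nothing; K_A, K_B and the Parity summit are NOT proved; nothing about
Landau–Siegel zeros.

## References
* E. Kowalski, P. Michel, J. VanderKam, J. reine angew. Math. 526 (2000), (21)–(28) pp. 12–15.
  [cite: KowalskiMichelVanderKam2000, (23)–(28) pp. 13–15 — derivation]
-/

noncomputable section

open scoped Real ArithmeticFunction.Moebius
open Complex MeasureTheory Polynomial Finset ArithmeticFunction
open Literature.NumberTheory.LFunctions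

namespace Summit.Parity.GeneralizedHardyLittlewood.Theorems.MomentsBeyondDiagonal.DiagLines

open Summit.Parity.GeneralizedHardyLittlewood.Theorems.PrimeLevelFamEdgeIdeaDeltas.PeterssonLayers
  (diagPart HasShape SubOf SubDiag)

/-- **`HasShape diagPart` FROM THE REAL PER-ORDER TARGETS IN DECORATED SELBERG COORDINATES** (`Δ ≤ 3/2`; orders
`(i,j) ≠ (0,0)` with `i+j` even; `τ₀₀ = secondMomentForm Δ' P 1 / 2`); notation in the module docstring.
[cite: KowalskiMichelVanderKam2000, (23)–(28) pp. 13–15 — derivation] -/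
theorem hasShape_diagPart_of_selbergOrderAsymptotics {Δ : ℝ} (hΔ : Δ ≤ 3 / 2) (τ : ℕ → ℕ → ℝ → ℝ[X] → ℝ)
    (h0 : ∀ (Δ' : ℝ) (P : ℝ[X]), τ 0 0 Δ' P = KMV2000.secondMomentForm Δ' P 1 / 2)
    (h : ∀ i j : ℕ, Even (i + j) → ¬(i = 0 ∧ j = 0) → ∀ P : ℝ[X], KMV2000.Admissible P → ∀ Δ' : ℝ, 1 < Δ' → Δ' ≤ Δ →
      ∃ C : ℝ, ∃ q₀ : ℕ, ∀ (q : ℕ) [NeZero q], q₀ ≤ q →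
        |(Real.log (KMV2000.qhat q))⁻¹ ^ (i + j) * KMV2000.qhat q *
          (∑ c ∈ Icc 1 ⌊KMV2000.qhat q ^ Δ'⌋₊, ∑ g ∈ Icc 1 (⌊KMV2000.qhat q ^ Δ'⌋₊ / c), (μ g : ℝ) * c *
            ∑ k₁ ∈ Icc 1 (⌊KMV2000.qhat q ^ Δ'⌋₊ / (c * g)), ∑ k₂ ∈ Icc 1 (⌊KMV2000.qhat q ^ Δ'⌋₊ / (c * g)),
              ((μ (c * g * k₁) : ℝ) * ((KMV2000.psi (c * g * k₁))⁻¹ *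
                  P.eval (Real.log (KMV2000.qhat q ^ Δ' / ((c * g * k₁ : ℕ) : ℝ)) / Real.log (KMV2000.qhat q ^ Δ'))) /
                  ((c * g * k₁ : ℕ) : ℝ)) *
              ((μ (c * g * k₂) : ℝ) * ((KMV2000.psi (c * g * k₂))⁻¹ *
                  P.eval (Real.log (KMV2000.qhat q ^ Δ' / ((c * g * k₂ : ℕ) : ℝ)) / Real.log (KMV2000.qhat q ^ Δ'))) /
                  ((c * g * k₂ : ℕ) : ℝ)) *
              ∑ d ∈ k₁.divisors, ∑ e ∈ k₂.divisors,
                ∫ u₁ in Set.Ioi (0 : ℝ),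
                  (Real.log (KMV2000.qhat q / ((k₁ / d * (g * e) : ℕ) : ℝ)) + Real.log u₁) ^ i *
                  ∫ u₂ in Set.Ioi ((((k₁ / d * (g * e) * (g * d * (k₂ / e)) : ℕ) : ℝ) / KMV2000.qhat q ^ 2) / u₁),
                    Real.exp (-(u₁ + u₂)) / (1 - Real.exp (-(u₁ + u₂))) ^ 2 *
                    (Real.log (KMV2000.qhat q / ((g * d * (k₂ / e) : ℕ) : ℝ)) + Real.log u₂) ^ j) -
          2 * (π ^ 2 / 6) ^ 2 * (KMV2000.qhat q / (Δ' ^ 2 * Real.log (KMV2000.qhat q) ^ 2)) * τ i j Δ' P| ≤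
          C * KMV2000.qhat q * (Real.log (KMV2000.qhat q))⁻¹ ^ 3) :
    HasShape (fun q _ P Q Δ' ↦ diagPart q P Q Δ') Δ
      (fun Δ' P Q ↦ ∑ i ∈ Finset.range (Q.natDegree + 1), ∑ j ∈ Finset.range (Q.natDegree + 1),
        Q.coeff i * Q.coeff j * (1 + (-1 : ℝ) ^ (i + j)) * τ i j Δ' P) := by
  refine hasShape_diagPart_of_orderAsymptotics_pos hΔ τ h0 ?_
  intro i j hij h00 P hP Δ' h1 h2
  obtain ⟨C, q₀, hC⟩ := h i j hij h00 P hP Δ' h1 h2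
  refine ⟨C, q₀, fun q _ hq ↦ ?_⟩
  have hq' := hC q hq
  -- the inner sum in decorated Selberg coordinates (real identity)
  have key := sum_mollifierCoeff_hecke_eq_decorated P (KMV2000.qhat q ^ Δ') ⌊KMV2000.qhat q ^ Δ'⌋₊
    (fun n₁ n₂ K ↦ ∫ u₁ in Set.Ioi (0 : ℝ), (Real.log (KMV2000.qhat q / (n₁ : ℝ)) + Real.log u₁) ^ i *
      ∫ u₂ in Set.Ioi (((K : ℕ) : ℝ) / KMV2000.qhat q ^ 2 / u₁),
        Real.exp (-(u₁ + u₂)) / (1 - Real.exp (-(u₁ + u₂))) ^ 2 *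
          (Real.log (KMV2000.qhat q / (n₂ : ℝ)) + Real.log u₂) ^ j)
  -- the complex expression is the cast of the real one
  have hcast : (((Real.log (KMV2000.qhat q))⁻¹ : ℝ) : ℂ) ^ (i + j) * (KMV2000.qhat q : ℂ) *
          ∑ m₁ ∈ Finset.Icc 1 ⌊KMV2000.qhat q ^ Δ'⌋₊, ∑ m₂ ∈ Finset.Icc 1 ⌊KMV2000.qhat q ^ Δ'⌋₊,
            (KMV2000.mollifierCoeff P (KMV2000.qhat q ^ Δ') m₁ : ℂ) *
              (KMV2000.mollifierCoeff P (KMV2000.qhat q ^ Δ') m₂ : ℂ) *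
            ∑ d₁ ∈ m₁.divisors, ∑ d₂ ∈ m₂.divisors,
              (((((m₁ / d₁).gcd (m₂ / d₂) : ℝ) * ((m₁ : ℝ) * m₂) ^ (-(1 / 2 : ℝ)) *
                (∫ u₁ in Set.Ioi (0 : ℝ),
                  (Real.log (KMV2000.qhat q / ((d₁ * (m₂ / d₂ / (m₁ / d₁).gcd (m₂ / d₂)) : ℕ) : ℝ)) + Real.log u₁) ^ i *
                  ∫ u₂ in Set.Ioi (((((m₁ / (m₁ / d₁).gcd (m₂ / d₂)) * (m₂ / (m₁ / d₁).gcd (m₂ / d₂)) : ℕ) : ℝ) /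
                      KMV2000.qhat q ^ 2) / u₁),
                    Real.exp (-(u₁ + u₂)) / (1 - Real.exp (-(u₁ + u₂))) ^ 2 *
                    (Real.log (KMV2000.qhat q / ((d₂ * (m₁ / d₁ / (m₁ / d₁).gcd (m₂ / d₂)) : ℕ) : ℝ)) + Real.log u₂) ^ j)) : ℝ) : ℂ) -
          ((2 * riemannZeta 2 ^ 2 *
              ((KMV2000.qhat q / (Δ' ^ 2 * Real.log (KMV2000.qhat q) ^ 2) : ℝ) : ℂ)) * ((τ i j Δ' P : ℝ) : ℂ)) =
      (((Real.log (KMV2000.qhat q))⁻¹ ^ (i + j) * KMV2000.qhat q *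
          (∑ m₁ ∈ Finset.Icc 1 ⌊KMV2000.qhat q ^ Δ'⌋₊, ∑ m₂ ∈ Finset.Icc 1 ⌊KMV2000.qhat q ^ Δ'⌋₊,
            KMV2000.mollifierCoeff P (KMV2000.qhat q ^ Δ') m₁ * KMV2000.mollifierCoeff P (KMV2000.qhat q ^ Δ') m₂ *
            ∑ d₁ ∈ m₁.divisors, ∑ d₂ ∈ m₂.divisors,
              ((m₁ / d₁).gcd (m₂ / d₂) : ℝ) * ((m₁ : ℝ) * m₂) ^ (-(1 / 2 : ℝ)) *
                ∫ u₁ in Set.Ioi (0 : ℝ),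
                  (Real.log (KMV2000.qhat q / ((d₁ * (m₂ / d₂ / (m₁ / d₁).gcd (m₂ / d₂)) : ℕ) : ℝ)) + Real.log u₁) ^ i *
                  ∫ u₂ in Set.Ioi (((((m₁ / (m₁ / d₁).gcd (m₂ / d₂)) * (m₂ / (m₁ / d₁).gcd (m₂ / d₂)) : ℕ) : ℝ) /
                      KMV2000.qhat q ^ 2) / u₁),
                    Real.exp (-(u₁ + u₂)) / (1 - Real.exp (-(u₁ + u₂))) ^ 2 *
                    (Real.log (KMV2000.qhat q / ((d₂ * (m₁ / d₁ / (m₁ / d₁).gcd (m₂ / d₂)) : ℕ) : ℝ)) + Real.log u₂) ^ j) -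
          2 * (π ^ 2 / 6) ^ 2 * (KMV2000.qhat q / (Δ' ^ 2 * Real.log (KMV2000.qhat q) ^ 2)) * τ i j Δ' P : ℝ) : ℂ) := by
    rw [riemannZeta_two]
    push_cast
    ring
  rw [hcast, Complex.norm_real, Real.norm_eq_abs, key]
  exact hq'

/-- **`SubDiag` FROM THE REAL PER-ORDER TARGETS IN DECORATED SELBERG COORDINATES** on some window `(1, Δ]`, `1 < Δ ≤ 3/2`
(orders `(i,j) ≠ (0,0)` with `i+j` even; `τ₀₀ = secondMomentForm Δ' P 1 / 2`): the exact remaining target list of the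
registered stub `stub_diag`, in the input form of the decorated engines. [cite: KowalskiMichelVanderKam2000, (23)–(28) pp. 13–15 — derivation] -/
theorem subDiag_of_selbergOrderAsymptotics {Δ : ℝ} (hΔ1 : 1 < Δ) (hΔ : Δ ≤ 3 / 2) (τ : ℕ → ℕ → ℝ → ℝ[X] → ℝ)
    (h0 : ∀ (Δ' : ℝ) (P : ℝ[X]), τ 0 0 Δ' P = KMV2000.secondMomentForm Δ' P 1 / 2)
    (h : ∀ i j : ℕ, Even (i + j) → ¬(i = 0 ∧ j = 0) → ∀ P : ℝ[X], KMV2000.Admissible P → ∀ Δ' : ℝ, 1 < Δ' → Δ' ≤ Δ →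
      ∃ C : ℝ, ∃ q₀ : ℕ, ∀ (q : ℕ) [NeZero q], q₀ ≤ q →
        |(Real.log (KMV2000.qhat q))⁻¹ ^ (i + j) * KMV2000.qhat q *
          (∑ c ∈ Icc 1 ⌊KMV2000.qhat q ^ Δ'⌋₊, ∑ g ∈ Icc 1 (⌊KMV2000.qhat q ^ Δ'⌋₊ / c), (μ g : ℝ) * c *
            ∑ k₁ ∈ Icc 1 (⌊KMV2000.qhat q ^ Δ'⌋₊ / (c * g)), ∑ k₂ ∈ Icc 1 (⌊KMV2000.qhat q ^ Δ'⌋₊ / (c * g)),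
              ((μ (c * g * k₁) : ℝ) * ((KMV2000.psi (c * g * k₁))⁻¹ *
                  P.eval (Real.log (KMV2000.qhat q ^ Δ' / ((c * g * k₁ : ℕ) : ℝ)) / Real.log (KMV2000.qhat q ^ Δ'))) /
                  ((c * g * k₁ : ℕ) : ℝ)) *
              ((μ (c * g * k₂) : ℝ) * ((KMV2000.psi (c * g * k₂))⁻¹ *
                  P.eval (Real.log (KMV2000.qhat q ^ Δ' / ((c * g * k₂ : ℕ) : ℝ)) / Real.log (KMV2000.qhat q ^ Δ'))) /
                  ((c * g * k₂ : ℕ) : ℝ)) *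
              ∑ d ∈ k₁.divisors, ∑ e ∈ k₂.divisors,
                ∫ u₁ in Set.Ioi (0 : ℝ),
                  (Real.log (KMV2000.qhat q / ((k₁ / d * (g * e) : ℕ) : ℝ)) + Real.log u₁) ^ i *
                  ∫ u₂ in Set.Ioi ((((k₁ / d * (g * e) * (g * d * (k₂ / e)) : ℕ) : ℝ) / KMV2000.qhat q ^ 2) / u₁),
                    Real.exp (-(u₁ + u₂)) / (1 - Real.exp (-(u₁ + u₂))) ^ 2 *
                    (Real.log (KMV2000.qhat q / ((g * d * (k₂ / e) : ℕ) : ℝ)) + Real.log u₂) ^ j) -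
          2 * (π ^ 2 / 6) ^ 2 * (KMV2000.qhat q / (Δ' ^ 2 * Real.log (KMV2000.qhat q) ^ 2)) * τ i j Δ' P| ≤
          C * KMV2000.qhat q * (Real.log (KMV2000.qhat q))⁻¹ ^ 3) :
    SubDiag :=
  ⟨Δ, hΔ1, _, hasShape_diagPart_of_selbergOrderAsymptotics hΔ τ h0 h⟩

end Summit.Parity.GeneralizedHardyLittlewood.Theorems.MomentsBeyondDiagonal.DiagLines

end
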